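/-
Copyright (c) 2026 the pub-hodgecm-mathlib formalisation cell (harness21).  Prover seat hodgecm-mathlib-LH4-p11 (g8), Track A «(D-RAM) FOUR-FRAME» squad, helper lane on
h413 = stmt-HodgeConjecture-24833 (count-neutral).  Heir dealer∕pen LH4-plan (g13) WORD #70 (2) ∕ WORD #82 (B) «DEFS leaf LabelledOddCountDefs = LH4-p11»; SPEC-B2 v1 3227ed60.
2026-09-04.
-/
import Summits.HodgeConjecture.HodgeConjecture.Theorems.F0P3cDyRamDiagonalKappaCountDefs   -- ★ p856497 (LH4-p05 (g3)): `cosetKappa`, `kappaCount`; brings ★ StrataDefs `polarisationCosets`, ★ TorusDefs, ★ #0a `normSign`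
import Summits.HodgeConjecture.HodgeConjecture.Theorems.F0P3cDyRamFourFramePieces          -- ★ DEFS №3: `valueSetMod`, `xPlus` (the reference value set of class `+`)
import HarnessLib

/-!
# Crux `H413`, line LH4 «(D-RAM) FOUR-FRAME» — DEFS LEAF «LABELLED ODD COUNT»: the polarisation classes of a lattice MODULO NORMS OF ITS UNIT STABILISER, the signed
# label of a class, and the labelled signed count `m^Λ_i(M₀)` — the per-orbit multiplicity of the labelled-odd Stage A of (β-BAL)

Cell `hodgecm-mathlib` (D-0151), FLOOR 0, crux item H413 = `stmt-HodgeConjecture-24833`, route `HCCMUnconditional`; squad F0∕P3c∕LH4.  DEFINITIONS + `Iff.rfl`∕`rfl`-grade ties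
ONLY (lane `--kind definition --supports stmt-HodgeConjecture-24833 --as helper`); no instance, no notation, no `sorry`; states NO law, pays NO row.  Precedents: ★ DEFS leaves
`F0P3cDyRamDiagonalStrataDefs` (`polarisationCosets`, `polarisationCount`), `F0P3cDyRamDiagonalKappaCountDefs` (`cosetKappa`, `kappaCount`).

WHY (SPEC-B2 v1 §1–§2; dealer WORD #82 (B)).  The (β-BAL) producer target is the eightfold ODD-character vanishing of the class-`+` clean-shell counts (★ p860156, hypothesis
`h8`).  Its label `Λ(M, D)` := «the `ϖ^{m*}`-thickened set of the values `Σ_j D_j x_j N(y_j)`, `y ∈ M`, equals `valueSetMod σ ϖ m* X₊`» is NOT invariant under the diagonal torus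
but EQUIVARIANT on (lattice, form) pairs — `Λ(diag(z)·M, D) ↔ Λ(M, D·N(z))` — hence a function of the polarisation `D ∈ Pol₀(M₀) = D₁·S_F(M₀)` of a normalised lattice `M₀` that
is INVARIANT under `D ↦ D·N(s)`, `s ∈ S̃(M₀) ∩ 𝒯` (unit diagonal stabiliser): `Λ(M₀, D·N(s)) = Λ(diag(s)M₀, D) = Λ(M₀, D)`.  The labelled Stage A (SPEC (B2a-2), dealt to LH4-p10
(g6)) sums such a label along a unit-torus orbit; the per-orbit multiplicity that comes out is the SIGNED LABEL COUNT OVER THE POLARISATION CLASSES MODULO `N(S̃(M₀) ∩ 𝒯)` —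
a finer quotient than ★ `polarisationCosets` (classes modulo `S_F(M₀)`), on which the label need not be constant (the «half∕half strata» of F0P3-p01 (g35)'s tables).  This
leaf names the objects so that (B2a-2)'s statement and the Stage-B tables are byte-compatible:
* §0 `IsTorusEquivariantLabel σ Λ` (the hypothesis shape `Λ(diag(z)M, D) ↔ Λ(M, D·N(z))`), `valueClassLabel σ ϖ x₀ x₁ m d` (the label of ★ p860156's `h8` as a pair predicate).
* §1 `polarisationNormClasses σ ϖ tv M` — the set of classes `D·N(S̃(M) ∩ 𝒯)` of the `σ`-fixed non-degenerate diagonal forms `diag(D)` of which `M` is a type-`tv` vertex.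
* §2 `classLabelSign σ i P C ∈ {−1, 0, 1}` — `ω(D_i)·[P D]` read on a class `C` on which both are constant (`1` if `P ∧ ω_i = 1` throughout `C`, `−1` if `P ∧ ω_i = −1` throughout,
  `0` otherwise — in particular `0` when `P` fails on the non-empty class); `P : (Fin 3 → K) → Prop` is the label at the lattice, `ω = normSign σ` the ODD character of slot `i`.
* §3 `labelledOddCount σ ϖ tv i Λ M := Σᶠ_{C ∈ polarisationNormClasses σ ϖ tv M} classLabelSign σ i (Λ M) C ∈ ℤ` — the `m^Λ_i(M)` of SPEC-B2 (B2a-2): along the unit-torus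
  orbit of a normalised `M₀`, `(Σ_e (−1)^{e_i}·#{labelled type-tv fibre of class e}) · [𝒰 : N(S̃(M₀) ∩ 𝒯)] = 8 · [𝒯 : S̃(M₀) ∩ 𝒯] · labelledOddCount σ ϖ tv i Λ M₀` (LH4-p10's
  brick; with `Λ ≡ True` it is `[S_F : N(S̃ ∩ 𝒯)]` times ★ (Oκ2b) for the odd character).
* §4 `Iff.rfl` ∕ `rfl` ties.
HONEST LABEL.  Count-neutral vocabulary; defines, asserts nothing; the eightfold vanishing, (β-BAL), (A″), (β) and the tier-0 T₊ row stay PROVER TARGETS; `HC_CM` is proved only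
modulo the 7 printed citations (2 remaining named inputs: hLiu418 = `stmt-HodgeConjecture-24832`, h413 = `stmt-HodgeConjecture-24833`) until rung 0 closes.

## References
* [Kottwitz1986BaseChangeUnits] R. E. Kottwitz, *Base change for unit elements of Hecke algebras*, Compositio Math. 60 (1986), §1 pp. 240–241 (κ-orbital integrals as signed
  lattice counts modulo the diagonal torus; stabiliser indices).
* [Rogawski1990] J. D. Rogawski, *Automorphic Representations of Unitary Groups in Three Variables*, Ann. of Math. Stud. 123 (1990), §4.9 Prop. 4.9.1 (a)(b) p. 55, §4.10 p. 58.
* [LanglandsShelstad1987] R. P. Langlands, D. Shelstad, *On the definition of transfer factors*, Math. Ann. 278 (1987), §1.3, §3 (the characters of `H¹(F, T) = (ℤ∕2)³`).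
* [Serre1979] J.-P. Serre, *Local Fields*, GTM 67 (1979), Ch. V §3 Cor. 3 (norm classes of units).
-/

set_option autoImplicit false

noncomputable section

namespace Summit.HodgeConjecture.HodgeConjecture.Cruxes.H413.F0P3cDyRamLabelledOddCountDefs

open Matrix
open Literature.NumberTheory.Automorphic Literature.NumberTheory.Automorphic.HermitianLattice
open Literature.NumberTheory.Automorphic.UnitaryLatticeTree Literature.NumberTheory.Automorphic.UnitaryThreeFourFrame
open Summit.HodgeConjecture.HodgeConjecture.Cruxes.H413.F0P3cDyRamDiagonalTorusDefs
open scoped Valued WithZero Matrix MatrixGroups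

variable {K : Type} [Field K]

/-! ## §0  Torus-equivariant labels of (lattice, form) pairs; the value-class label of record -/

section WithValuation0

variable [Valued K ℤᵐ⁰]

/-- **A TORUS-EQUIVARIANT LABEL** of (lattice, form) pairs: `Λ(diag(z)·M, D) ↔ Λ(M, D·N(z))` for every diagonal `z ∈ (K^×)³` (`N(z)_j = z_j·σz_j`).  The level tokens of a
diagonal operator are such labels trivially in `D` (★ `latticeInLevel_diagonal_mapGL_iff`); the value-class label below is the one that is NOT `D`-trivial (SPEC-B2 v1 §1 (EQ)).
The hypothesis shape of the labelled-odd Stage A (B2a-2). [cite: Kottwitz1986BaseChangeUnits, §1 pp. 240–241] -/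
def IsTorusEquivariantLabel (σ : K →+* K) (Λ : Submodule 𝒪[K] (Fin 3 → K) → (Fin 3 → K) → Prop) : Prop :=
  ∀ (z : Fin 3 → Kˣ) (M : Submodule 𝒪[K] (Fin 3 → K)) (D : Fin 3 → K),
    Λ (mapGL (diagGLUnits z) M) D ↔ Λ M (fun j => D j * (((z j : Kˣ) : K) * σ ((z j : Kˣ) : K)))

/-- **THE VALUE-CLASS LABEL OF RECORD** `valueClassLabel σ ϖ x₀ x₁ m d M D`: «the `ϖ^m`-thickened set of the binary norm-form values `D₀·x₀·N(y₀) + D₁·x₁·N(y₁)`, `y ∈ M`, equals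
the reference set `valueSetMod σ ϖ m (xPlus σ ϖ d)` of class `+`» — the label of the eightfold hypothesis `h8` of ★ p860156 (`x₀ = α − 1`, `x₁ = β − 1`, `m = m*`, `D = d_e`), read
as a predicate of the PAIR (lattice, form).  Torus-equivariant (`N((zy)_j) = N(z_j)N(y_j)`; ★ p860071 §3). [cite: Rogawski1990, §4.9 Prop. 4.9.1 (b) p. 55] [cite: Kottwitz1986BaseChangeUnits, §1 pp. 240–241] -/
def valueClassLabel (σ : K →+* K) (ϖ : K) (x₀ x₁ : K) (m d : ℕ) (M : Submodule 𝒪[K] (Fin 3 → K)) (D : Fin 3 → K) : Prop :=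
  {v : K | ∃ y ∈ M, Valued.v ((ϖ ^ m)⁻¹ * (v - (D 0 * x₀ * (y 0 * σ (y 0)) + D 1 * x₁ * (y 1 * σ (y 1))))) ≤ 1} =
    F0P3cDyRamFourFramePieces.valueSetMod σ ϖ m (F0P3cDyRamFourFramePieces.xPlus σ ϖ d)

end WithValuation0

/-! ## §1  The polarisation classes modulo norms of the unit stabiliser -/

section WithValuation

variable [Valued K ℤᵐ⁰]

/-- **THE POLARISATION CLASSES MODULO `N(S̃(M) ∩ 𝒯)`**: the set of classes `D·N(S̃(M) ∩ 𝒯) = {D' | D'_j = D_j·n_j, n = N(s), s a UNIT diagonal stabiliser of M}` of the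
`σ`-fixed non-degenerate diagonal forms `diag(D)` of which `M` is a type-`tv` vertex lattice.  Finer than ★ `polarisationCosets σ ϖ tv M` (classes modulo `S_F(M)`; under (NI2)
`N(S̃ ∩ 𝒯) ≤ S_F`, ★ (O2b) Step 1): a torus-EQUIVARIANT label of (lattice, form) pairs is constant on these classes but not in general on the coarser ones (SPEC-B2 v1 §1).
[cite: Kottwitz1986BaseChangeUnits, §1 pp. 240–241] [cite: Serre1979, Ch. V §3 Cor. 3] -/
def polarisationNormClasses (σ : K →+* K) (ϖ : K) (tv : ℕ) (M : Submodule 𝒪[K] (Fin 3 → K)) : Set (Set (Fin 3 → K)) :=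
  {C | ∃ D : Fin 3 → K, ((∀ i, σ (D i) = D i ∧ D i ≠ 0) ∧ IsVertexLattice σ ϖ (Matrix.diagonal D) tv M) ∧
    C = {D' : Fin 3 → K | ∃ n ∈ (unitStabilizer M).map (unitNormMap σ 3), ∀ i, D' i = D i * ((n i : Kˣ) : K)}}

end WithValuation

/-! ## §2  The signed label of a class of forms -/

open Classical in
/-- **THE SIGNED LABEL OF A SET OF FORMS** for slot `i` and a label `P` of forms: `1` if `P D ∧ ω(D_i) = 1` for every `D ∈ C`, `−1` if `P D ∧ ω(D_i) = −1` for every `D ∈ C`,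
`0` otherwise (`ω = normSign σ`, ★ #0a H1).  On a class `C` on which `P` and `ω(·_i)` are constant this is `ω(D_i)·[P D]` for any `D ∈ C` (and `0` when `P` fails on the non-empty
class) — the ODD-character analogue, with a label riding along, of ★ `cosetKappa`. [cite: LanglandsShelstad1987, §3] [cite: Kottwitz1986BaseChangeUnits, §1 pp. 240–241] -/
def classLabelSign (σ : K →+* K) (i : Fin 3) (P : (Fin 3 → K) → Prop) (C : Set (Fin 3 → K)) : ℤ :=
  if (∀ D ∈ C, P D ∧ normSign σ (D i) = 1) then 1 else if (∀ D ∈ C, P D ∧ normSign σ (D i) = -1) then -1 else 0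

/-! ## §3  The labelled signed count of a lattice -/

section WithValuation

variable [Valued K ℤᵐ⁰]

/-- **THE LABELLED ODD COUNT `m^Λ_i(M)` at vertex type `tv`** — the sum of the signed labels of the polarisation classes of `M` modulo `N(S̃(M) ∩ 𝒯)`:
`labelledOddCount σ ϖ tv i Λ M = Σᶠ_{C ∈ polarisationNormClasses σ ϖ tv M} classLabelSign σ i (Λ M) C ∈ ℤ`, for a label `Λ : lattices → forms → Prop` (read at `M`).  It is
the per-orbit multiplicity of the labelled-odd Stage A of (β-BAL) (SPEC-B2 v1 (B2a-2): `(Σ_e (−1)^{e_i}·#{labelled class-e fibres along 𝒯·M₀})·[𝒰 : N(S̃(M₀) ∩ 𝒯)] =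
8·[𝒯 : S̃(M₀) ∩ 𝒯]·labelledOddCount σ ϖ tv i Λ M₀`); `0` off the polarisable set; with `Λ ≡ True` it is `[S_F(M) : N(S̃(M) ∩ 𝒯)]·ω(D₁,i)·[ω(·_i) ≡ 1 on S_F(M)]`.
[cite: Kottwitz1986BaseChangeUnits, §1 pp. 240–241] [cite: Rogawski1990, §4.9 Prop. 4.9.1 (a)(b) p. 55] [cite: LanglandsShelstad1987, §3] -/
def labelledOddCount (σ : K →+* K) (ϖ : K) (tv : ℕ) (i : Fin 3) (Λ : Submodule 𝒪[K] (Fin 3 → K) → (Fin 3 → K) → Prop)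
    (M : Submodule 𝒪[K] (Fin 3 → K)) : ℤ :=
  ∑ᶠ C ∈ polarisationNormClasses σ ϖ tv M, classLabelSign σ i (Λ M) C

/-! ## §4  Ties -/

/-- Unfolding `IsTorusEquivariantLabel`, `Iff.rfl`. [cite: Kottwitz1986BaseChangeUnits, §1 pp. 240–241] -/
theorem isTorusEquivariantLabel_iff (σ : K →+* K) (Λ : Submodule 𝒪[K] (Fin 3 → K) → (Fin 3 → K) → Prop) :
    IsTorusEquivariantLabel σ Λ ↔ ∀ (z : Fin 3 → Kˣ) (M : Submodule 𝒪[K] (Fin 3 → K)) (D : Fin 3 → K),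
      Λ (mapGL (diagGLUnits z) M) D ↔ Λ M (fun j => D j * (((z j : Kˣ) : K) * σ ((z j : Kˣ) : K))) := Iff.rfl

/-- Unfolding `valueClassLabel`, `Iff.rfl`. [cite: Rogawski1990, §4.9 Prop. 4.9.1 (b) p. 55] -/
theorem valueClassLabel_iff (σ : K →+* K) (ϖ : K) (x₀ x₁ : K) (m d : ℕ) (M : Submodule 𝒪[K] (Fin 3 → K)) (D : Fin 3 → K) :
    valueClassLabel σ ϖ x₀ x₁ m d M D ↔
      {v : K | ∃ y ∈ M, Valued.v ((ϖ ^ m)⁻¹ * (v - (D 0 * x₀ * (y 0 * σ (y 0)) + D 1 * x₁ * (y 1 * σ (y 1))))) ≤ 1} =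
        F0P3cDyRamFourFramePieces.valueSetMod σ ϖ m (F0P3cDyRamFourFramePieces.xPlus σ ϖ d) := Iff.rfl

/-- Membership in `polarisationNormClasses`, `Iff.rfl`. [cite: Kottwitz1986BaseChangeUnits, §1 pp. 240–241] -/
theorem mem_polarisationNormClasses_iff (σ : K →+* K) (ϖ : K) (tv : ℕ) (M : Submodule 𝒪[K] (Fin 3 → K)) (C : Set (Fin 3 → K)) :
    C ∈ polarisationNormClasses σ ϖ tv M ↔ ∃ D : Fin 3 → K, ((∀ i, σ (D i) = D i ∧ D i ≠ 0) ∧ IsVertexLattice σ ϖ (Matrix.diagonal D) tv M) ∧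
      C = {D' : Fin 3 → K | ∃ n ∈ (unitStabilizer M).map (unitNormMap σ 3), ∀ i, D' i = D i * ((n i : Kˣ) : K)} := Iff.rfl

/-- Unfolding `labelledOddCount`, `rfl`. [cite: Kottwitz1986BaseChangeUnits, §1 pp. 240–241] -/
theorem labelledOddCount_eq (σ : K →+* K) (ϖ : K) (tv : ℕ) (i : Fin 3) (Λ : Submodule 𝒪[K] (Fin 3 → K) → (Fin 3 → K) → Prop)
    (M : Submodule 𝒪[K] (Fin 3 → K)) :
    labelledOddCount σ ϖ tv i Λ M = ∑ᶠ C ∈ polarisationNormClasses σ ϖ tv M, classLabelSign σ i (Λ M) C := rfl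

/-- No type-`tv` polarisation ⟹ no classes ⟹ `labelledOddCount = 0` (so the labelled Stage-A sums may run over all of `𝓛₀(T)`). [cite: Kottwitz1986BaseChangeUnits, §1 pp. 240–241] -/
theorem labelledOddCount_eq_zero_of_not_exists (σ : K →+* K) (ϖ : K) (tv : ℕ) (i : Fin 3) (Λ : Submodule 𝒪[K] (Fin 3 → K) → (Fin 3 → K) → Prop)
    (M : Submodule 𝒪[K] (Fin 3 → K)) (h : ¬ ∃ D : Fin 3 → K, (∀ i, σ (D i) = D i ∧ D i ≠ 0) ∧ IsVertexLattice σ ϖ (Matrix.diagonal D) tv M) :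
    labelledOddCount σ ϖ tv i Λ M = 0 := by
  have he : polarisationNormClasses σ ϖ tv M = ∅ :=
    Set.eq_empty_of_forall_notMem fun C ⟨D, hD, _⟩ => h ⟨D, hD.1, hD.2⟩
  rw [labelledOddCount, he, finsum_mem_empty]

end WithValuation

open Classical in
/-- The signed label of a class, unfolded (`rfl`). [cite: LanglandsShelstad1987, §3] -/
theorem classLabelSign_eq (σ : K →+* K) (i : Fin 3) (P : (Fin 3 → K) → Prop) (C : Set (Fin 3 → K)) :
    classLabelSign σ i P C =
      if (∀ D ∈ C, P D ∧ normSign σ (D i) = 1) then 1 else if (∀ D ∈ C, P D ∧ normSign σ (D i) = -1) then -1 else 0 := rfl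

/-- If the label fails at some `D ∈ C`, the signed label of `C` is `0`. [cite: LanglandsShelstad1987, §3] -/
theorem classLabelSign_eq_zero_of_not (σ : K →+* K) (i : Fin 3) (P : (Fin 3 → K) → Prop) {C : Set (Fin 3 → K)} {D : Fin 3 → K} (hD : D ∈ C) (hP : ¬ P D) :
    classLabelSign σ i P C = 0 := by
  rw [classLabelSign_eq, if_neg (fun h => hP (h D hD).1), if_neg (fun h => hP (h D hD).1)]

/-- If `P D ∧ ω(D_i) = 1` throughout `C`, the signed label is `1`. [cite: LanglandsShelstad1987, §3] -/
theorem classLabelSign_eq_one_of_forall (σ : K →+* K) (i : Fin 3) (P : (Fin 3 → K) → Prop) {C : Set (Fin 3 → K)} (h : ∀ D ∈ C, P D ∧ normSign σ (D i) = 1) :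
    classLabelSign σ i P C = 1 := by
  rw [classLabelSign_eq, if_pos h]

/-- If `C` is non-empty and `P D ∧ ω(D_i) = −1` throughout `C`, the signed label is `−1`. [cite: LanglandsShelstad1987, §3] -/
theorem classLabelSign_eq_neg_one_of_forall (σ : K →+* K) (i : Fin 3) (P : (Fin 3 → K) → Prop) {C : Set (Fin 3 → K)} (hne : C.Nonempty)
    (h : ∀ D ∈ C, P D ∧ normSign σ (D i) = -1) : classLabelSign σ i P C = -1 := by
  obtain ⟨D, hD⟩ := hne
  have h1 : ¬ ∀ D ∈ C, P D ∧ normSign σ (D i) = 1 := fun h' => by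
    have := (h D hD).2; rw [(h' D hD).2] at this; exact absurd this (by decide)
  rw [classLabelSign_eq, if_neg h1, if_pos h]

end Summit.HodgeConjecture.HodgeConjecture.Cruxes.H413.F0P3cDyRamLabelledOddCountDefs

end
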